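import Summits.AtomisticToContinuum.HydrodynamicLimit.Theses.UGibbsSRBRigidity
import HarnessLib

/-!
# Birth skeleton (BC3) for crux `GronwallUInBand` — item stmt-AtomisticToContinuum-17738,
# route `UGibbsSRBRigidity` (rank 9, glue crux), sub-problem `HydrodynamicLimit`

Crux BY NAME: `Summit.AtomisticToContinuum.HydrodynamicLimit.Theses.UGibbsSRBRigidity.GronwallUInBand`
`= URegularLimitsSlaved → URigiditySlaved → GaussianTails → RelEntropyVanishingInBand` — the
relative-entropy Gronwall of Olla–Varadhan–Yau 1993 §3–5 run for the DETERMINISTIC hard-sphere flow on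
`𝕋³`, in the packing band, consuming only the Gibbsianity of dynamical local limits (U1 = inheritance of
u-regularity by OVY limit states, U2 = u-Gibbs rigidity) and the large-velocity input `GaussianTails`.

## The cut — OVY 1993 §4 made into typed seams (the route file's foreseen glued split
## "GronwallUInBand ⇐ Descent → OVYGronwallInBand", with §4 (A)–(C) and the in-band statics separated)

* `stub_limitStates` — **LIMIT STATES AND THEIR DYNAMICS (OVY §4 (A)–(C), deterministic), size M/L**:
  `URegularLimitsSlaved → LimitStatesRegular`: every limit point `μ` of the WEIGHTED space–time averaged
  blown-up laws (weight `H(t,x) ≥ 0` continuous — the laws the Gronwall argument actually meets, with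
  `H = ∂λ`-type weights and cut-offs; `H ≡ 1` is the tree's `IsOVYLimitState`) along a subsequence `κ`
  is translation invariant of finite density and kinetic energy, is DOMINATED (`μ ≤ C • μᵤ`) by a
  uniform OVY limit state `μᵤ` carrying U1's structure (equilibrium translation-covariant infinite flow
  `Ψ`, a.e. defined, stationary, Sinai short-window cluster pin, u-regular), is itself `Ψ`-stationary,
  and — the content — the blown-up torus dynamics CONVERGES LOCALLY IN LAW TO `Ψ` along `κ` (two-time
  Laplace functionals at microscopic lag `s ≥ 0`, macroscopic lag `ε_N s`). Tools: tightness from the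
  conservation laws, finite specific entropy of limit points (entropy is conserved by the Liouville flow),
  uniqueness and continuity of finite-cluster hard-sphere dynamics at entropy-typical data.
* `stub_descent` — **DESCENT (OVY §4 (D)–(E) with Thm 2.1 ↦ U2), size L**: `URigiditySlaved →
  ∃ η₁ > 0, DescentBelow η₁`: for EVERY (not necessarily ergodic) translation-invariant, stationary,
  cluster-pinned, u-regular probability law `μ` of finite density and energy under an equilibrium
  translation-covariant flow `Ψ`, every probability law `ν ≤ c • μ` that is translation invariant and
  `Ψ`-stationary is, CONDITIONED ON THE LOW-DENSITY INVARIANT EVENT `{0 < d̄ < η₁}` (`d̄` = asymptotic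
  empirical density over the centred cubes), a mixture of hard-sphere Gibbs states — `η₁ :=` U2's
  threshold. Tools: ergodic decomposition for the joint space–time action, `d̄ =` component density,
  descent of stationarity / a.e.-definedness / cluster pin / u-REGULARITY to the jointly ergodic
  components (the step with no template in print), U2 componentwise, measurable re-integration.
* `stub_statics` — **IN-BAND STATICS OF THE REFERENCE (cluster expansion), size M/L**:
  `∃ η₂ > 0, ReferenceStaticsBelow η₂`: smooth equation of state on `[0, η₂)` and a smooth positive
  activity function `α` of the reduced density such that the canonical local Gibbs laws with activity
  `x ↦ α(ρ(x)σ³)` built on any continuous in-band normalised profile are probability measures obeying an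
  exponential law of large numbers at `(ρ, ρu, E)` (sibling items 0767/0768; Ruelle 1969, Lebowitz–Penrose
  1964).
* `stub_gronwall` — **THE DETERMINISTIC OVY GRONWALL IN THE BAND (OVY §3, §5), size XL, load-bearing**:
  `∀ η₁ η₂ > 0, LimitStatesGibbsBelow η₁ → ReferenceStaticsBelow η₂ → GaussianTails →
  RelEntropyVanishingInBand`, where `LimitStatesGibbsBelow η₁` is the PLAQUE-FREE interface (weighted
  limit states: translation invariant, finite density/energy, stationary for an equilibrium covariant
  flow with cluster pin, local convergence of the dynamics, hereditary Gibbsianity of the low-density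
  part). Inside: entropy production for the torus flow with contact currents (the jump of `log ψ_t` at a
  contact is the collisional transfer; its expectation passes to the limit through the two-time laws),
  linear terms cancelled by the Euler solution, Nachtergaele–Yau truncation of the cubic energy current
  paid by `GaussianTails`, bad blocks `{d̄ ≥ η₁}` and quadratic fluctuations by the reference large
  deviations and the entropy inequality, one-block replacement under the Gibbsian low-density limit
  states, virial theorem / EOS identification of the Gibbs currents with `hsPressure`, Gronwall; the
  prover chooses the target's packing threshold `η₀ ≤ min(η₂, η₁/2)` (units `ρσ³ = d̄` of the blow-up by
  the sphere diameter).

Composition: `limitStatesGibbsBelow_of` assembles the plaque-free interface from stubs 1–2 (domination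
`ν ≤ c • μ ≤ (cC) • μᵤ`, absolute continuity for the a.e. clauses — the u-regular vocabulary is
eliminated at this seam), and `GronwallUInBand_of` threads U1, U2, `GaussianTails` through the four
stubs; both are real proofs. The hypotheses of `GronwallUInBand_of` are the stub statements BY NAME
(`Sig.stub_*`, definitionally the signatures of the four sorried stubs, so that the A12 audit sees
registered obligations only); `GronwallUInBand_skeleton` applies it to the sorried stubs themselves.

## Disproof used
No `Cruxes/GronwallUInBand/Disproof.lean` exists for this crux (no `_false_without_` theorem, no landed
`Theorems/GronwallUInBand/Negative/*`); `ledger negatives --problem AtomisticToContinuum` lists no statement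
of this file. Route-level negatives honoured: the u-regular class enters only through U1/U2 BY NAME over
the contact-slaved functor D5 (the D4 ghost-recoil vacuity does not enter; the zero measure is u-regular,
`isURegular_zero`, so no clause here is vacuous-by-emptiness), and the target is the PACKING-GUARDED
`RelEntropyVanishingInBand` (implosion / dense-excursion witnesses against the unguarded 0766 bear on no
stub). Typing checklist 4c: every `∫`/`laplaceFunctional` limit clause is guarded by `IsFiniteMeasure μ`
(a junk Bochner value cannot satisfy the hypotheses vacuously), thresholds are `∃ η`, never hand-picked.
-/

noncomputable section

namespace Summit.AtomisticToContinuum.HydrodynamicLimit.Cruxes.GronwallUInBand.Birth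

open scoped ENNReal NNReal Topology ContDiff
open MeasureTheory Filter Set
open Literature.Analysis.FunctionSpaces Literature.Analysis.FluidPDE
open Literature.MathematicalPhysics.KineticTheory
open Summit.AtomisticToContinuum.HydrodynamicLimit.Theses.UGibbsSRBRigidity

/-! ## Plaque-free intermediate notions -/

/-- The ASYMPTOTIC EMPIRICAL DENSITY `d̄(ξ) ∈ [0, ∞]` of a configuration of `ℝ³ × ℝ³`: `limsup` over the
centred cubes `Λ_n = [-(n+1), n+1)³` of (number of points with position in `Λ_n`) / `|Λ_n|`. For a
translation-invariant law of finite density it is a.s. the conditional density given the invariant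
σ-algebra (pointwise ergodic theorem), hence the density of the ergodic component. [folklore] -/
def asympDensity (ξ : PointConfig (V3 × V3)) : ℝ≥0∞ :=
  limsup (fun n : ℕ =>
    ((ξ.count (Prod.fst ⁻¹' PointProcess.centredBox (d := Fin 3) n) : ℕ∞) : ℝ≥0∞) /
      volume (PointProcess.centredBox (d := Fin 3) n)) atTop

/-- The LOW-DENSITY (translation-invariant) event `{0 < d̄ < η₁}` on which u-Gibbs rigidity (U2,
density in `(0, η₀)`) classifies the jointly ergodic components. [folklore] -/
def lowDensitySet (η₁ : ℝ≥0∞) : Set (PointConfig (V3 × V3)) :=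
  {ξ | 0 < asympDensity ξ ∧ asympDensity ξ < η₁}

/-- SINAI'S SHORT-WINDOW CLUSTER PIN of a law `μ` under the infinite flow `Ψ` (verbatim the clause of
U1/U2): for some `δ > 0`, a.s. every particle's collision cluster over every time window of length `δ` is
finite. [cite: OllaVaradhanYau1993, §4 (B)] -/
def ClusterPin (Ψ : InfiniteHardSphereFlow (Fin 3) 1) (μ : Measure (PointConfig (V3 × V3))) : Prop :=
  ∃ δ : ℝ, 0 < δ ∧ ∀ᵐ (ξ : PointConfig (V3 × V3)) ∂μ, ∀ p ∈ (ξ : Set (V3 × V3)), ∀ a : ℝ,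
    (collisionCluster 1 (ξ : Set (V3 × V3)) (Ψ.traj ξ) a (a + δ) p).Finite

/-- The WEIGHTED TWO-TIME OVY FUNCTIONAL: `T₀⁻¹ ∫₀^{T₀} dt ∫_{𝕋³} dx H(t,x) E[exp(-∑ᵢ f(ω_{t,x})ᵢ -
∑ᵢ g(ω_{t+ε s,x})ᵢ)]`, the Laplace functional of the pair (configuration blown up around `x` at time
`t`, the same at the macroscopic time `t + ε_N s`, i.e. after MICROSCOPIC time `s`), averaged with the
weight `H ≥ 0` — with `H ≡ 1`, `g ≡ 0` this is the tree's `ovyLaplace` (OVY 1993 (4.1)).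
[cite: OllaVaradhanYau1993, §4 (4.1) and (B)] -/
def ovyLaplaceW (σ : ℝ) (a₀ θ₀ : T3 → ℝ) (u₀ : T3 → V3) (T₀ : ℝ) (H : ℝ → T3 → ℝ) (s : ℝ) (N : ℕ)
    (Φ : HardSphereFlow (Torus.geometry (Fin 3)) (hsDiameter σ N) (N + 1)) (f g : V3 × V3 → ℝ) : ℝ :=
  T₀⁻¹ * ∫ t in Set.Ioc 0 T₀, ∫ x : T3, H t x *
    ∫ z, Real.exp (-(∑ i, f (blowUpPoint (hsDiameter σ N) x (Φ.flow t z i)))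
        - ∑ i, g (blowUpPoint (hsDiameter σ N) x (Φ.flow (t + hsDiameter σ N * s) z i)))
      ∂(localGibbsLaw σ a₀ u₀ θ₀ N Φ)

/-- `μ` is the WEIGHTED LIMIT STATE along the subsequence `κ`: the one-time weighted functionals converge
to the Laplace functionals of `μ` for every continuous compactly supported `f ≥ 0`.
[cite: OllaVaradhanYau1993, §4 (A) and Lemma 4.1] -/
def IsWeightedLimitAlong (σ : ℝ) (a₀ θ₀ : T3 → ℝ) (u₀ : T3 → V3) (T₀ : ℝ) (H : ℝ → T3 → ℝ)
    (Φ : (N : ℕ) → HardSphereFlow (Torus.geometry (Fin 3)) (hsDiameter σ N) (N + 1)) (κ : ℕ → ℕ)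
    (μ : Measure (PointConfig (V3 × V3))) : Prop :=
  ∀ f : V3 × V3 → ℝ, Continuous f → HasCompactSupport f → (∀ p, 0 ≤ f p) →
    Tendsto (fun n => ovyLaplaceW σ a₀ θ₀ u₀ T₀ H 0 (κ n) (Φ (κ n)) f 0) atTop
      (𝓝 (PointProcess.laplaceFunctional μ f))

/-- LOCAL CONVERGENCE OF THE DYNAMICS along `κ`: the two-time weighted functionals at every microscopic
lag `s ≥ 0` converge to the pair functional of `(ξ, Ψ_s ξ)` under `μ` — the blown-up torus dynamics
converges locally in law to the infinite flow `Ψ` (OVY 1993 §4 (B), proved there for the noisy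
dynamics). [cite: OllaVaradhanYau1993, §4 (B)] -/
def TwoTimeLimitAlong (σ : ℝ) (a₀ θ₀ : T3 → ℝ) (u₀ : T3 → V3) (T₀ : ℝ) (H : ℝ → T3 → ℝ)
    (Φ : (N : ℕ) → HardSphereFlow (Torus.geometry (Fin 3)) (hsDiameter σ N) (N + 1)) (κ : ℕ → ℕ)
    (μ : Measure (PointConfig (V3 × V3))) (Ψ : InfiniteHardSphereFlow (Fin 3) 1) : Prop :=
  ∀ s : ℝ, 0 ≤ s → ∀ f g : V3 × V3 → ℝ, Continuous f → HasCompactSupport f → (∀ p, 0 ≤ f p) →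
    Continuous g → HasCompactSupport g → (∀ p, 0 ≤ g p) →
    Tendsto (fun n => ovyLaplaceW σ a₀ θ₀ u₀ T₀ H s (κ n) (Φ (κ n)) f g) atTop
      (𝓝 (∫ ξ, Real.exp (-(∑ᶠ p ∈ (ξ : Set (V3 × V3)), f p)
          - ∑ᶠ p ∈ ((Ψ.flow s ξ : PointConfig (V3 × V3)) : Set (V3 × V3)), g p) ∂μ))

/-- **Structure and dynamics of the weighted limit states** (OVY 1993 §4 (A)–(C) for the deterministic
gas, given U1): for all continuous positive profiles there is `σ₀` such that for `σ < σ₀`, all flows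
`Φ_N`, `T₀ > 0`, continuous weights `H ≥ 0`, every FINITE weighted limit state `μ` along `κ` is
translation invariant of finite density and kinetic energy, dominated by a uniform OVY limit state `μᵤ`
that carries U1's structure for a flow `Ψ` (equilibrium, translation covariant, a.e. defined,
stationary, cluster pin, u-regular for the contact-slaved plaques), is itself `Ψ`-stationary, and the
dynamics converges locally in law to `Ψ` along `κ`. [cite: OllaVaradhanYau1993, §4 (A)–(C), Lemma 4.1–4.2] -/
def LimitStatesRegular : Prop :=
  ∀ (a₀ θ₀ : T3 → ℝ) (u₀ : T3 → V3), Continuous a₀ → Continuous θ₀ → Continuous u₀ →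
    (∀ x, 0 < a₀ x) → (∀ x, 0 < θ₀ x) →
    ∃ σ₀ : ℝ, 0 < σ₀ ∧ ∀ σ : ℝ, 0 < σ → σ < σ₀ →
      ∀ (Φ : (N : ℕ) → HardSphereFlow (Torus.geometry (Fin 3)) (hsDiameter σ N) (N + 1)) (T₀ : ℝ),
        0 < T₀ → ∀ H : ℝ → T3 → ℝ, Continuous (Function.uncurry H) → (∀ t x, 0 ≤ H t x) →
        ∀ (μ : Measure (PointConfig (V3 × V3))) (κ : ℕ → ℕ), StrictMono κ →
          IsWeightedLimitAlong σ a₀ θ₀ u₀ T₀ H Φ κ μ → IsFiniteMeasure μ →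
          IsTranslationInvariant μ ∧ PointProcess.density μ < ⊤ ∧
          Literature.MathematicalPhysics.KineticTheory.kineticEnergyDensity μ < ⊤ ∧
          ∃ (μu : Measure (PointConfig (V3 × V3))) (C : ℝ≥0∞) (Ψ : InfiniteHardSphereFlow (Fin 3) 1),
            C ≠ ⊤ ∧ μ ≤ C • μu ∧ IsOVYLimitState σ a₀ θ₀ u₀ T₀ Φ μu ∧ IsProbabilityMeasure μu ∧
            IsTranslationInvariant μu ∧ PointProcess.density μu < ⊤ ∧
            Literature.MathematicalPhysics.KineticTheory.kineticEnergyDensity μu < ⊤ ∧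
            Ψ.IsEquilibriumFlow ∧ Ψ.IsTranslationCovariant ∧ Ψ.IsAEDefined μu ∧ Ψ.IsStationary μu ∧
            ClusterPin Ψ μu ∧ (Literature.Dynamics.Billiards.slavedUnstablePlaques 1 Ψ).IsURegular μu ∧
            Ψ.IsStationary μ ∧ TwoTimeLimitAlong σ a₀ θ₀ u₀ T₀ H Φ κ μ Ψ

/-- **Descent below `η₁`** (the plaque-consuming half: OVY 1993 §4 (D)–(E) with the noisy ergodic
theorem replaced by u-Gibbs rigidity): for every equilibrium, translation-covariant infinite hard-sphere
flow `Ψ` and every translation-invariant, `Ψ`-a.e. defined, `Ψ`-stationary, cluster-pinned, u-regular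
probability law `μ` of finite density and kinetic energy, every probability law `ν ≤ c • μ` that is
translation invariant and `Ψ`-stationary and charges `{0 < d̄ < η₁}` is, conditioned on that event, a
mixture of hard-sphere Gibbs states `g_{z,β,u}`. [cite: OllaVaradhanYau1993, §4 (D)–(E), Lemma 4.7–4.8] -/
def DescentBelow (η₁ : ℝ≥0∞) : Prop :=
  ∀ Ψ : InfiniteHardSphereFlow (Fin 3) 1, Ψ.IsEquilibriumFlow → Ψ.IsTranslationCovariant →
    ∀ μ : Measure (PointConfig (V3 × V3)), IsProbabilityMeasure μ → IsTranslationInvariant μ →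
      Ψ.IsAEDefined μ → Ψ.IsStationary μ → ClusterPin Ψ μ → PointProcess.density μ < ⊤ →
      Literature.MathematicalPhysics.KineticTheory.kineticEnergyDensity μ < ⊤ →
      (Literature.Dynamics.Billiards.slavedUnstablePlaques 1 Ψ).IsURegular μ →
      ∀ (ν : Measure (PointConfig (V3 × V3))) (c : ℝ≥0∞), c ≠ ⊤ → ν ≤ c • μ →
        IsProbabilityMeasure ν → IsTranslationInvariant ν → Ψ.IsStationary ν →
        ν (lowDensitySet η₁) ≠ 0 →
        IsHardSphereGibbsMixture 1 (ProbabilityTheory.cond ν (lowDensitySet η₁))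

/-- **Gibbsianity of the low-density part of the dynamical local limits** — the PLAQUE-FREE interface
consumed by the Gronwall (OVY 1993 §4 (A)–(E) in one statement): for all continuous positive profiles
there is `σ₀` such that for `σ < σ₀`, all flows, `T₀ > 0`, continuous weights `H ≥ 0`, every finite
weighted limit state `μ` along `κ` is translation invariant of finite density and kinetic energy, is
stationary, a.e. defined and cluster-pinned for some equilibrium translation-covariant infinite flow `Ψ`
to which the blown-up dynamics converges locally in law along `κ`, and every probability law `ν ≤ c • μ`
that is translation invariant and `Ψ`-stationary and charges `{0 < d̄ < η₁}` is, conditioned on it, a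
mixture of hard-sphere Gibbs states. [cite: OllaVaradhanYau1993, §4 (A)–(E)] -/
def LimitStatesGibbsBelow (η₁ : ℝ≥0∞) : Prop :=
  ∀ (a₀ θ₀ : T3 → ℝ) (u₀ : T3 → V3), Continuous a₀ → Continuous θ₀ → Continuous u₀ →
    (∀ x, 0 < a₀ x) → (∀ x, 0 < θ₀ x) →
    ∃ σ₀ : ℝ, 0 < σ₀ ∧ ∀ σ : ℝ, 0 < σ → σ < σ₀ →
      ∀ (Φ : (N : ℕ) → HardSphereFlow (Torus.geometry (Fin 3)) (hsDiameter σ N) (N + 1)) (T₀ : ℝ),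
        0 < T₀ → ∀ H : ℝ → T3 → ℝ, Continuous (Function.uncurry H) → (∀ t x, 0 ≤ H t x) →
        ∀ (μ : Measure (PointConfig (V3 × V3))) (κ : ℕ → ℕ), StrictMono κ →
          IsWeightedLimitAlong σ a₀ θ₀ u₀ T₀ H Φ κ μ → IsFiniteMeasure μ →
          IsTranslationInvariant μ ∧ PointProcess.density μ < ⊤ ∧
          Literature.MathematicalPhysics.KineticTheory.kineticEnergyDensity μ < ⊤ ∧
          ∃ Ψ : InfiniteHardSphereFlow (Fin 3) 1, Ψ.IsEquilibriumFlow ∧ Ψ.IsTranslationCovariant ∧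
            Ψ.IsAEDefined μ ∧ Ψ.IsStationary μ ∧ ClusterPin Ψ μ ∧
            TwoTimeLimitAlong σ a₀ θ₀ u₀ T₀ H Φ κ μ Ψ ∧
            ∀ (ν : Measure (PointConfig (V3 × V3))) (c : ℝ≥0∞), c ≠ ⊤ → ν ≤ c • μ →
              IsProbabilityMeasure ν → IsTranslationInvariant ν → Ψ.IsStationary ν →
              ν (lowDensitySet η₁) ≠ 0 →
              IsHardSphereGibbsMixture 1 (ProbabilityTheory.cond ν (lowDensitySet η₁))

/-- **In-band statics of the local Gibbs reference** (cluster-expansion regime of the hard-sphere gas,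
Ruelle 1969 §3.4/§4.2, Lebowitz–Penrose 1964): (i) the excess free energy per particle is the
restriction to `[0, η₂)` of a smooth function (so the compressibility factor `Z = 1 + η f_ex'` and the
pressure law `hsPressure` are smooth in the band); (ii) an ACTIVITY FUNCTION `α` of the reduced density,
smooth and positive on `(0, η₂)`, such that for every `σ > 0` and every continuous profile `(ρ, u, θ)`
with `ρ, θ > 0`, `ρσ³ < η₂` pointwise and `∫ρ = 1` (canonical normalisation, `N + 1` particles), the
canonical local Gibbs law of `N + 1` spheres of diameter `σ(N+1)^{-1/3}` with activity profile
`x ↦ α(ρ(x)σ³)` is a probability measure and its empirical density / momentum / energy fields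
concentrate exponentially around `(ρ, ρu, E(ρ,u,θ))`, uniformly in `N` and in the flow (the form of the
sibling items 0767 `LocalGibbsConcentration` and 0768 `HsEosLowDensity`).
[cite: Ruelle1969, §3.4 and §4.2 Thm 4.2.3] -/
def ReferenceStaticsBelow (η₂ : ℝ) : Prop :=
  (∃ F : ℝ → ℝ, ContDiff ℝ ∞ F ∧ Set.EqOn hsExcessFreeEnergy F (Set.Ico 0 η₂)) ∧
  ∃ α : ℝ → ℝ, ContDiffOn ℝ ∞ α (Set.Ioo 0 η₂) ∧ (∀ r ∈ Set.Ioo 0 η₂, 0 < α r) ∧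
    ∀ σ : ℝ, 0 < σ → ∀ (ρ θ : T3 → ℝ) (u : T3 → V3), Continuous ρ → Continuous θ → Continuous u →
      (∀ x, 0 < ρ x) → (∀ x, 0 < θ x) → (∀ x, ρ x * σ ^ 3 < η₂) → ∫ x, ρ x = 1 →
      (∀ (N : ℕ) (Φ : HardSphereFlow (Torus.geometry (Fin 3)) (hsDiameter σ N) (N + 1)),
          IsProbabilityMeasure (localGibbsLaw σ (fun x => α (ρ x * σ ^ 3)) u θ N Φ)) ∧
      ∀ χ : T3 → ℝ, Continuous χ → ∀ δ : ℝ, 0 < δ → ∃ C : ℝ, 0 < C ∧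
        ∀ (N : ℕ) (Φ : HardSphereFlow (Torus.geometry (Fin 3)) (hsDiameter σ N) (N + 1)),
          localGibbsLaw σ (fun x => α (ρ x * σ ^ 3)) u θ N Φ
              {z | δ < |empiricalDensityField z χ - ∫ x, χ x * ρ x|} ≤
            ENNReal.ofReal (C * Real.exp (-(C⁻¹ * (N + 1)))) ∧
          localGibbsLaw σ (fun x => α (ρ x * σ ^ 3)) u θ N Φ
              {z | δ < ‖empiricalMomentumField z χ - ∫ x, (χ x * ρ x) • u x‖} ≤
            ENNReal.ofReal (C * Real.exp (-(C⁻¹ * (N + 1)))) ∧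
          localGibbsLaw σ (fun x => α (ρ x * σ ^ 3)) u θ N Φ
              {z | δ < |empiricalEnergyField z χ - ∫ x, χ x * totalEnergyDensity (ρ x) (u x) (θ x)|} ≤
            ENNReal.ofReal (C * Real.exp (-(C⁻¹ * (N + 1))))

/-! ## Stub statements by name (the hypotheses of `GronwallUInBand_of`) -/

namespace Sig

/-- Statement of `stub_limitStates`. [folklore] -/
def stub_limitStates : Prop :=
  URegularLimitsSlaved → LimitStatesRegular

/-- Statement of `stub_descent`. [folklore] -/
def stub_descent : Prop :=
  URigiditySlaved → ∃ η₁ : ℝ≥0∞, 0 < η₁ ∧ DescentBelow η₁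

/-- Statement of `stub_statics`. [folklore] -/
def stub_statics : Prop :=
  ∃ η₂ : ℝ, 0 < η₂ ∧ ReferenceStaticsBelow η₂

/-- Statement of `stub_gronwall`. [folklore] -/
def stub_gronwall : Prop :=
  ∀ (η₁ : ℝ≥0∞) (η₂ : ℝ), 0 < η₁ → 0 < η₂ →
    LimitStatesGibbsBelow η₁ → ReferenceStaticsBelow η₂ → GaussianTails → RelEntropyVanishingInBand

end Sig

/-! ## The stubs -/

/-- **Stub 1 — LIMIT STATES AND THEIR DYNAMICS (size M/L).** U1 (every uniform OVY limit state is a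
translation-invariant probability law of finite density and energy, stationary, a.e. defined,
cluster-pinned and u-regular for some equilibrium translation-covariant flow `Ψ`) implies the structure
of all WEIGHTED limit states: domination by a uniform OVY limit state carrying U1's structure,
translation invariance, finite density and energy, `Ψ`-stationarity, and local convergence in law of the
blown-up torus dynamics to `Ψ`. Why plausibly true: `Q_H^ε ≤ ‖H‖_∞ Q^ε`, tightness from the
conservation laws (OVY Lemma 4.1), and the deterministic form of OVY §4 (B): finite specific entropy of
limit points (entropy is Liouville-invariant, Lemma 4.2) puts them on locally absolutely continuous
configurations, where finite-cluster hard-sphere dynamics (the cluster pin) is unique and continuous, so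
the finite dynamics converges to `Ψ` and time-averaging makes weighted limits stationary. Why it might
fail: far fast particles (no finite propagation speed) must be excluded with only second velocity moments
along the evolved law; the identification of the local limit dynamics with U1's `Ψ` needs uniqueness of
cluster-pinned stationary flows `μᵤ`-a.e. Leans on: `URegularLimitsSlaved`, `IsOVYLimitState`,
`PointProcess.IsVagueClusterPoint`, `InfiniteHardSphereFlow` API, Kallenberg Thm 16.16 (tightness /
convergence of random measures; not in Mathlib). [cite: OllaVaradhanYau1993, §4 (A)–(C), Lemma 4.1–4.2] -/
theorem stub_limitStates : URegularLimitsSlaved → LimitStatesRegular := by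
  sorry

/-- **Stub 2 — DESCENT (size L; the step with no template in print).** U2 (u-Gibbs rigidity below
density `η₀` for jointly space–time ERGODIC states) implies Gibbsianity of the low-density part
`{0 < d̄ < η₀}` of every — not necessarily ergodic — translation-invariant, stationary, cluster-pinned,
u-regular probability law of finite density and energy, hereditarily for the translation-invariant
stationary probability laws it dominates; `η₁ :=` U2's `η₀`. Why plausibly true: it is the
ergodic-decomposition bookkeeping of OVY 1993 §4 (D)–(E) with Thm 2.1 ↦ U2: decompose along the joint
space–time invariant σ-algebra, read the component density off `d̄` (pointwise ergodic theorem), pass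
stationarity / a.e.-definedness / the a.s. cluster pin / finite energy to a.e. component, apply U2 on the
components charging `{0 < d̄ < η₁}`, re-integrate (mixtures of mixtures are mixtures, `Measure.bind`);
a dominated invariant `ν = h μ` has `h` invariant-measurable, so its components are reweighted components
of `μ`. For genuine SRB measures the descent of a.c. unstable conditionals to ergodic components is
Ledrappier–Young 1985 §6. Why it might fail: contact-slaved window plaques are not semi-invariant under
`Ψ_t`, so the Hopf-type argument placing a.e. plaque inside one joint-ergodic class has no template;
measurable selection of the Gibbs parametrisation `θ ↦ κ θ`. Leans on: `URigiditySlaved`,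
`PlaqueFamily.IsURegular` (+ `smul/add/bind`), `IsHardSphereGibbsMixture`, Mathlib `condExpKernel`
(no ready-made ergodic decomposition for `ℝ³ × ℝ`-actions).
[cite: OllaVaradhanYau1993, §4 (D)–(E), Lemma 4.7–4.8] [cite: LedrappierYoung1985, §6 (6.1)–(6.2)] -/
theorem stub_descent : URigiditySlaved → ∃ η₁ : ℝ≥0∞, 0 < η₁ ∧ DescentBelow η₁ := by
  sorry

/-- **Stub 3 — IN-BAND STATICS OF THE REFERENCE (size M/L).** There is a packing threshold `η₂ > 0`
below which the hard-sphere excess free energy is smooth and the canonical local Gibbs laws with the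
inverse-EOS activity profile are probability measures obeying an exponential law of large numbers at the
prescribed continuous in-band profile. Why plausibly true: convergence of the Mayer/virial expansion at
small packing (Lebowitz–Penrose 1964; Ruelle 1969 §4.2 Thm 4.2.3) gives analyticity of pressure and
density in the activity, hence of `f_ex` on `[0, η₂)` and of the inverse relation `α = n ↦ z =
n·exp(f_ex(n) + n f_ex'(n))`; the exponential LLN is the large-deviation upper bound of the inhomogeneous
dilute canonical gas with a strictly convex rate in the band (equivalence of ensembles; the activity
profile is only defined up to a constant, fixed by `∫ρ = 1`). Why it might fail: only through a
normalisation slip — `∫ρ = 1` is required and assumed; `σ³ = σ³∫ρ < η₂` keeps the torus packing below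
`η₂`, and `η₂ ≤ 1/8` makes the hard-core domain non-empty for every `N` (cubic arrangement), so the
laws are probability measures. Leans on: `hsExcessFreeEnergy`, `localGibbsLaw`, `canonicalDensity`,
the weaker vendored fact `localGibbs_lln` (not assumed), sibling items 0767/0768 (same content).
[cite: Ruelle1969, §3.4 and §4.2 Thm 4.2.3] -/
theorem stub_statics : ∃ η₂ : ℝ, 0 < η₂ ∧ ReferenceStaticsBelow η₂ := by
  sorry

/-- **Stub 4 — THE DETERMINISTIC OVY GRONWALL IN THE BAND (size XL, load-bearing).** Given the
plaque-free structure of the weighted limit states below any threshold `η₁ > 0` (translation invariance,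
finite density/energy, stationarity and cluster pin for an equilibrium covariant flow, local convergence
of the dynamics, hereditary Gibbsianity of the low-density part), the in-band statics below any
`η₂ > 0`, and Gaussian velocity tails along the true evolution, the relative entropy per particle of the
evolved law with respect to the local Gibbs reference built on a classical hard-sphere Euler solution
confined to the packing band `ρ_t σ³ < η₀ := min(η₂, η₁/2, …)` tends to zero: `RelEntropyVanishingInBand`.
Why plausibly true: it is Olla–Varadhan–Yau 1993 §3 and §5 (Thm 5.1) once the properties of limit points
(§4) are supplied — here by hypothesis, for exactly the laws the argument meets (weighted space–time
averages with `H = ` derivatives of the dual variables and cut-offs, their two-time versions for the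
collisional transfer) — with the cubic energy current truncated à la Nachtergaele–Yau 2003 (paid by
`GaussianTails`) and bad blocks `{d̄ ≥ η₁}` and quadratic fluctuations priced by the reference large
deviations through the entropy inequality. Why it might fail: the entropy-production identity for the
torus flow with hard-core CONTACT currents (collision bookkeeping of the jump of `log ψ_t`) has never been
written; the virial theorem identifying the expected collisional transfer under a Gibbs state and the
hard-sphere flow with `ρθ(Z(ρσ³) - 1)` must be proved inside (0782 is informal); uniform integrability of
the collision functionals along the two-time limit. Leans on: `GaussianTails`, `IsHardSphereGibbsMixture`,
`IsHardSphereEulerSolution`, `Literature.Probability.Entropy.KipnisLandim1999_A1_8_2` (entropy inequality),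
`Summit.AtomisticToContinuum.HydrodynamicLimit.Theorems.tendstoHydroFieldsAt_of_klDiv` (pattern), Mathlib
`InformationTheory.klDiv`. [cite: OllaVaradhanYau1993, §3 Lemma 3.1–3.4 and §5 Thm 5.1] [cite: NachtergaeleYau2003, Lemma 3.2, Lemma 5.1, Thm 7.1] -/
theorem stub_gronwall :
    ∀ (η₁ : ℝ≥0∞) (η₂ : ℝ), 0 < η₁ → 0 < η₂ →
      LimitStatesGibbsBelow η₁ → ReferenceStaticsBelow η₂ → GaussianTails →
        RelEntropyVanishingInBand := by
  sorry

/-! ## Composition: the stubs conclude the crux BY NAME (real proofs, no `sorry`) -/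

/-- **The seam between stubs 1–2 and stub 4**: the plaque-free interface `LimitStatesGibbsBelow η₁`
follows from the structure of weighted limit states (stub 1's conclusion) and the descent below `η₁`
(stub 2's conclusion): the a.e. clauses pass from the dominating OVY state `μᵤ` to `μ ≤ C • μᵤ` by
absolute continuity, and a dominated `ν ≤ c • μ` is dominated by `μᵤ` with constant `cC`, where the
descent applies with U1's u-regularity of `μᵤ` — the plaque vocabulary is discharged here. [folklore] -/
theorem limitStatesGibbsBelow_of (hL : LimitStatesRegular) {η₁ : ℝ≥0∞} (hD : DescentBelow η₁) :
    LimitStatesGibbsBelow η₁ := by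
  intro a₀ θ₀ u₀ ha hθ hu ha0 hθ0
  obtain ⟨σ₀, hσ₀, hσ⟩ := hL a₀ θ₀ u₀ ha hθ hu ha0 hθ0
  refine ⟨σ₀, hσ₀, fun σ hs hs' Φ T₀ hT₀ H hH hH0 μ κ hκ hlim hfin => ?_⟩
  obtain ⟨hTI, hd, hKE, μu, C, Ψ, hC, hle, -, hprob, hTIu, hdu, hKEu, hEq, hCov, hAEu, hSu, hpin,
    hU, hSμ, h2⟩ := hσ σ hs hs' Φ T₀ hT₀ H hH hH0 μ κ hκ hlim hfin
  have hac : μ ≪ μu := Measure.absolutelyContinuous_of_le_smul hle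
  refine ⟨hTI, hd, hKE, Ψ, hEq, hCov, hac.ae_le hAEu, hSμ, ?_, h2, ?_⟩
  · obtain ⟨δ, hδ, hδ'⟩ := hpin
    exact ⟨δ, hδ, hac.ae_le hδ'⟩
  · intro ν c hc hνle hν hνTI hνS hlow
    have hle' := Measure.le_iff'.1 hle
    have hνle' : ν ≤ (c * C) • μu := by
      refine hνle.trans (Measure.le_iff'.2 fun s => ?_)
      have h1 : μ s ≤ C * μu s := by simpa only [Measure.smul_apply, smul_eq_mul] using hle' s
      simp only [Measure.smul_apply, smul_eq_mul, mul_assoc]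
      gcongr
    exact hD Ψ hEq hCov μu hprob hTIu hAEu hSu hpin hdu hKEu hU ν (c * C) (ENNReal.mul_ne_top hc hC)
      hνle' hν hνTI hνS hlow

/-- **The skeleton theorem.** Limit states ∘ descent ∘ statics ∘ Gronwall: given U1, U2 and Gaussian
tails, build the plaque-free interface below U2's threshold `η₁` from stubs 1–2, take the statics
threshold `η₂` from stub 3, and run the deterministic OVY Gronwall, stub 4. [folklore] -/
theorem GronwallUInBand_of :
    Sig.stub_limitStates → Sig.stub_descent → Sig.stub_statics → Sig.stub_gronwall →
      Summit.AtomisticToContinuum.HydrodynamicLimit.Theses.UGibbsSRBRigidity.GronwallUInBand := by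
  intro hL hD hS hG h₁ h₂ h₃
  obtain ⟨η₁, hη₁, hDesc⟩ := hD h₂
  obtain ⟨η₂, hη₂, hR⟩ := hS
  exact hG η₁ η₂ hη₁ hη₂ (limitStatesGibbsBelow_of (hL h₁) hDesc) hR h₃

/-- The same composition applied to the sorried stubs themselves (checks that the four `Sig.*`
statements are definitionally the stubs' signatures). [folklore] -/
theorem GronwallUInBand_skeleton :
    Summit.AtomisticToContinuum.HydrodynamicLimit.Theses.UGibbsSRBRigidity.GronwallUInBand :=
  GronwallUInBand_of stub_limitStates stub_descent stub_statics stub_gronwall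

end Summit.AtomisticToContinuum.HydrodynamicLimit.Cruxes.GronwallUInBand.Birth

end
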